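import Literature.MathematicalPhysics.QuantumLattice.GrassmannKernelsPresented

/-!
# Kernel calculus of the left derivative `∂_X` and of the fermionic Laplacian `Δ_C`
# (crux `SeededBrokenRegimeBoseFermiPinned` = stmt-HubbardSuperconductivity-14047, route AposterioriCapRg; supports, lead c4)

Restatement-invariant analysis layer, part 1.  Salmhofer's antisymmetric kernels
(`kernel R F m X = (m!)⁻¹ · constPart (∂_{X_{m-1}} ⋯ ∂_{X_0} F)`, `GrassmannKernels.lean`) of a DERIVATIVE and of a
LAPLACIAN of a Grassmann polynomial, in closed form:

* `iterDeriv_cons` — `∂_{X_{m-1}} ⋯ ∂_{X_0} ∂_Y = iterDeriv (Y, X_0, …, X_{m-1})`;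
* **`kernel_grassmannDeriv`** (registered stub `stub_kernelGrassmannDeriv`) —
  `kernel (∂_Y F) m X = (m + 1) · kernel F (m + 1) (Y, X)`: differentiating lowers the degree by one and costs the
  factor `m + 1` (the number of positions the removed leg could occupy in an antisymmetric kernel);
* **`kernel_grassmannLaplacian`** (registered stub `stub_kernelGrassmannLaplacian`) — for
  `Δ_C = ½ Σ_{X,Y} C(X,Y) ∂_X ∂_Y` (`GrassmannLaplacian.lean`),
  `kernel (Δ_C F) m Z = ½ (m + 2)(m + 1) Σ_{X,Y} C(X,Y) · kernel F (m + 2) (Y, X, Z)`.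

These are the coefficient identities behind the `L¹–L^∞` power counting of the two terms of Polchinski's equation
(`hasDerivAt_apply_effAction`, landed): a contraction `Δ_C` trades two legs of `F_{m+2}` for one covariance entry and
the combinatorial factor `(m+2)(m+1)/2` (Salmhofer 1998, §4.1, proof of Lemma 1; Gawȩdzki–Kupiainen 1985, §3).

Sources: M. Salmhofer, Commun. Math. Phys. 194 (1998) 249–295, §3.2 (3.12)–(3.14), §4.1 [`Salmhofer1998`];
M. Salmhofer, *Renormalization* (1999), §4.3 (4.95)–(4.97) [`Salmhofer1999`].  Finite-dimensional bookkeeping; folklore.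
-/

set_option linter.dupNamespace false -- `Summit.<S>.<S>` doubles the summit name (tree convention)

namespace Summit.HubbardSuperconductivity.HubbardSuperconductivity.Theorems.AposterioriCapRgSeededBrokenRegimeBoseFermiPinned

open Literature.MathematicalPhysics.QuantumLattice GrassmannAlgebra

namespace KernelCalculus

variable {R : Type*} [CommRing R] {Γ : Type*}

/-- `iterDeriv (Y, X_0, …, X_{m-1}) = iterDeriv X ∘ ∂_Y` (the derivative in the new first slot acts first). [folklore] -/
theorem iterDeriv_cons (Y : Γ) {m : ℕ} (X : Fin m → Γ) :
    iterDeriv R (Fin.cons Y X : Fin (m + 1) → Γ) = iterDeriv R X * grassmannDeriv R Y := by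
  simp only [iterDeriv, List.ofFn_succ, Fin.cons_zero, Fin.cons_succ, List.reverse_cons, List.prod_append,
    List.prod_singleton]

variable [Algebra ℚ R]

/-- **The kernels of a left derivative**: `kernel (∂_Y F) m X = (m + 1) · kernel F (m + 1) (Y, X)`
(Salmhofer 1998, §3.2: `δ/δψ(X)` on the kernel expansion; the factor `m + 1` counts the slots of the removed leg).
[cite: Salmhofer1998, §3.2 (3.12)-(3.14)] -/
theorem kernel_grassmannDeriv (F : GrassmannAlgebra R Γ) (Y : Γ) (m : ℕ) (X : Fin m → Γ) :
    kernel R (grassmannDeriv R Y F) m X = ((m + 1 : ℕ) : R) * kernel R F (m + 1) (Fin.cons Y X) := by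
  rw [kernel_def, kernel_def, iterDeriv_cons, Module.End.mul_apply, ← mul_assoc]
  congr 1
  have hn : ((m + 1 : ℕ) : R) = ((m + 1 : ℕ) : ℚ) • (1 : R) := by
    rw [Nat.cast_smul_eq_nsmul, nsmul_eq_mul, mul_one]
  rw [hn, smul_mul_smul_comm, one_mul, Nat.factorial_succ, Nat.cast_mul, mul_inv, ← mul_assoc,
    mul_inv_cancel₀ (by positivity), one_mul]

/-- **The kernels of the fermionic Laplacian** `Δ_C = ½ Σ_{X,Y} C(X,Y) ∂_X ∂_Y`:
`kernel (Δ_C F) m Z = ½ (m + 2)(m + 1) · Σ_{X,Y} C(X,Y) · kernel F (m + 2) (Y, X, Z)` (Salmhofer 1998, §4.1, the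
contraction step in the proof of Lemma 1). [cite: Salmhofer1998, §4.1] -/
theorem kernel_grassmannLaplacian [Fintype Γ] (C : Matrix Γ Γ R) (F : GrassmannAlgebra R Γ) (m : ℕ)
    (Z : Fin m → Γ) :
    kernel R (grassmannLaplacian R C F) m Z =
      ((1 / 2 : ℚ) • (1 : R)) * (((m + 2) * (m + 1) : ℕ) : R) *
        ∑ X, ∑ Y, C X Y * kernel R F (m + 2) (Fin.cons Y (Fin.cons X Z)) := by
  rw [grassmannLaplacian_apply, kernel_smul]
  simp only [kernel_sum (R := R), kernel_smul, kernel_grassmannDeriv, Finset.mul_sum]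
  refine Finset.sum_congr rfl fun X _ => Finset.sum_congr rfl fun Y _ => ?_
  push_cast
  ring

end KernelCalculus

/-! ### The registered stubs -/

/-- **W1 (`stub_kernelGrassmannDeriv`)**: `kernel (∂_Y F) m X = (m + 1) · kernel F (m + 1) (Y, X)`.
[cite: Salmhofer1998, §3.2 (3.12)-(3.14)] -/
theorem stub_kernelGrassmannDeriv :
    ∀ {R : Type} [CommRing R] [Algebra ℚ R] {Γ : Type} (F : GrassmannAlgebra R Γ) (Y : Γ) (m : ℕ) (X : Fin m → Γ),
      kernel R (grassmannDeriv R Y F) m X = ((m + 1 : ℕ) : R) * kernel R F (m + 1) (Fin.cons Y X) := by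
  intro R _ _ Γ F Y m X
  exact KernelCalculus.kernel_grassmannDeriv F Y m X

/-- **W2 (`stub_kernelGrassmannLaplacian`)**: `kernel (Δ_C F) m Z = ½ (m + 2)(m + 1) Σ_{X,Y} C(X,Y) kernel F (m + 2) (Y, X, Z)`.
[cite: Salmhofer1998, §4.1] -/
theorem stub_kernelGrassmannLaplacian :
    ∀ {R : Type} [CommRing R] [Algebra ℚ R] {Γ : Type} [Fintype Γ] (C : Matrix Γ Γ R) (F : GrassmannAlgebra R Γ)
      (m : ℕ) (Z : Fin m → Γ),
      kernel R (grassmannLaplacian R C F) m Z =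
        ((1 / 2 : ℚ) • (1 : R)) * (((m + 2) * (m + 1) : ℕ) : R) *
          ∑ X, ∑ Y, C X Y * kernel R F (m + 2) (Fin.cons Y (Fin.cons X Z)) := by
  intro R _ _ Γ _ C F m Z
  exact KernelCalculus.kernel_grassmannLaplacian C F m Z

end Summit.HubbardSuperconductivity.HubbardSuperconductivity.Theorems.AposterioriCapRgSeededBrokenRegimeBoseFermiPinned
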